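import Literature.Barriers.FinalStateConjecture.TrappingDerivativeLossBeams
import Literature.Barriers.FinalStateConjecture.TrappingDerivativeLossGeodesicBeams
import Literature.Barriers.FinalStateConjecture.TrappingDerivativeLossGeodesicBeamsProofs
import HarnessLib

/-!
# Discharges of named facts of `TrappingDerivativeLossInputs.lean`

`Literature/Barriers/FinalStateConjecture/TrappingDerivativeLossInputsDischarges.lean` —
proofs-only sibling of `TrappingDerivativeLossInputs.lean` (no definitions, no named facts).
Each theorem below closes a named fact `X : Prop` of that file as `X_holds : X` by composing
an ACCEPTED reduction theorem of the tree with the ACCEPTED unconditional `_holds` discharges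
of all of its hypotheses; nothing is re-proved and no statement is changed. Recorded by the
librarian sweep g25 (2026-08-16, pass 5c: facts dischargeable in one line from the tree's own
lemmas), so that the facts census, `#h21_route_deps` and the cone guardrail see these facts as
theorems.

Discharged here:

* `SbierskiKerrGaussianBeams_holds` := `of_trappedGeodesicBeams`
  `KerrNullGeodesicGaussianBeams_holds)` (`TrappingDerivativeLossBeams.lean`).

## References

* [Sbierski2015] — see `lean/references.bib` and the docstring of the fact in `TrappingDerivativeLossInputs.lean`.
-/

namespace Literature.Barriers.FinalStateConjecture

/-- **Discharge of the named fact `SbierskiKerrGaussianBeams`**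
(`TrappingDerivativeLossInputs.lean`): (B) Sbierski's Gaussian beams along the trapped null
geodesics of Kerr (named fact; the geometric-optics input of Thm. 5.1/7.4). Sbierski, Anal.
PDE 8 (2015): (i) proof of Thm. 2.1 and §3 (arXiv §2.1–2.2): … — obtained as
`of_trappedGeodesicBeams` applied to the tree's unconditional discharge
`KerrNullGeodesicGaussianBeams_holds)` of its hypothesis (reduction in
`TrappingDerivativeLossBeams.lean`).
[cite: Sbierski2015, proof of Thm. 2.1 with arXiv Thm. 7 (§2.3) and §7A] -/
theorem SbierskiKerrGaussianBeams_holds :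
    SbierskiKerrGaussianBeams :=
  Literature.Barriers.FinalStateConjecture.SbierskiKerrGaussianBeams.of_trappedGeodesicBeams
    (Literature.Barriers.FinalStateConjecture.SbierskiKerrTrappedGeodesicBeams.of_nullGeodesicBeams' Literature.Barriers.FinalStateConjecture.KerrNullGeodesicGaussianBeams_holds)

end Literature.Barriers.FinalStateConjecture
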